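/-
Copyright: b2b-lace packet (ENUMERATION SHARD A, gen 65; node N76-STAR02-ADD child ROW2-BAR'' as carved by CARVER gens 53–54).
[FvdH17] §6.1 "Case a = 0, b ≥ 2" / §5.1 "Elements of the bounds": the ENTRY INEQUALITY for the §6.1-typed element
`(Ā''^ι)_{0,2} = sup_y Σ_x Σ_κ T_{1,1̲,0}(−(x+y), e_κ−(x+y), −y)` (the REPULSIVE triangle whose middle line is the unit
bond) by the exact-leg slot bound of [NoBLE17] §5.3.2 (5.40) at every fixed endpoint, with endpoint-class count
majorants.  Proofs only; no named fact; no numeral; no dimension.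
-/
import Literature.Probability.FitznerVanDerHofstad2017.NobleBlocksDoublePrime
import Literature.Probability.FitznerVanDerHofstad2017.NobleExactLegSlots
import Literature.Probability.FitznerVanDerHofstad2017.SawCountRecursion
import HarnessLib

/-!
# [FvdH17] §6.1 / §5.1: the §6.1-typed entry `(Ā''^ι)_{0,2}` — the repulsive triangle `T_{1,1̲,0}` by EXL-XSLOT

Reproduction module (build `lace`, LEAN-IN-TREE RULE) in the package of
R. Fitzner, R. van der Hofstad, *Mean-field behavior for nearest-neighbor percolation in `d > 10`*,
Electron. J. Probab. **22** (2017) no. 43 [FvdH17] (arXiv:1506.07977v2): §6.1 "Bound in terms of diagrams: N ≥ 1",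
Case `a = 0, b ≥ 2` (p. 59), §5.1 "Elements of the bounds" (p. 49), App. B display (B.5c) row `(0,2)` (p. 78),
§4.2 (4.17)–(4.18) (p. 36); and of
R. Fitzner, R. van der Hofstad, *Generalized approach to the non-backtracking lace expansion*,
Probab. Theory Relat. Fields **169** (2017) [NoBLE17] (arXiv:1506.07969): §5.3.2 (5.40) (p. 1098).

The additive family `Ā''` of `NobleBlocksDoublePrime` types row `(0,2)` of the double-open triangle with the
REPULSIVE letter `T_{1,1̲,0}` that §6.1 actually produces; its closed form is
`NobleBlocks.matAbarIota''_zero_two : (Ā''^ι)_{0,2} = sup_y Σ'_x Σ_κ T_{≥1,1̲,≥0}(−(x+y), e_κ−(x+y), −y)`.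
For a fixed out-gap `y` the map `(x, κ) ↦ (−(x+y), e_κ−(x+y))` is injective, so the `y`-member is at most the
full two-vertex letter sum `Σ'_v Σ'_u T_{≥1,1̲,≥0}(v, u, −y)` (private re-indexing helper), which is the
interior-exact-leg slot instance `(m₁, m₃) = (1, 0)` of the LANDED `tsum_tsum_perc_T_ge_eqOne_ge_le_ofReal`
([NoBLE17] (5.40): the exact bond costs one unit of length and no multiplicity; slot lists `[M]`, `[M−1, 1]`,
`1 ≤ M`) at the endpoint `−y` (`perc_tsum_sum_T_shift_le_xslot`).  Taking the supremum over `y` by endpoint class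
(`{0}`, odd `ℓ¹`-norm, even `ℓ¹`-norm `≠ 0` — the trail-word counts to an endpoint vanish off its parity class, so
the natural count majorants are class-wise, exactly as in `NobleExactLegSlotsRowTwo`):

* **`perc_matAbarIota''_zero_two_le_xslot₃`** —
  `(Ā''^ι)_{0,2} ≤ ofReal (max slot₀ (max slot_odd slot_even))`, `slot_c = bubbleSlotR p Γ̄₂ 1 1 M_c N_c R₁ R₂`
  with independent slot orders `M_c ≥ 1`, count majorants `N_c` and remainder constants per class;
* **`perc_matAbarIota''_zero_two_le_xslot`** — the one-class form on `Set.univ`.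

Every `d ≥ 2`, `p < p_c(ℤ^d)`; nothing is evaluated; no named fact; all theorems kernel-checked modulo the standard
axioms.  The identification with the notebook numerals is NOT part of this module.

[cite: FitznerVanDerHofstad2017, §6.1 "Case a = 0, b ≥ 2" (arXiv:1506.07977v2 p. 59); §5.1 "Elements of the bounds" (p. 49); App. B (B.5c) row (0,2) (p. 78); §4.2 (4.17)–(4.18) (p. 36)]
[cite: FitznerVanDerHofstad2016NoBLE, §5.3.2 (5.40) (PTRF 169 (2017) p. 1098)]
-/

namespace Literature.Probability.FitznerVanDerHofstad2017.NobleBlocks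

open _root_.MeasureTheory Finset
open scoped BigOperators ENNReal
open Literature.Probability.LatticeModels Literature.Probability.Percolation
open Literature.Barriers.CriticalPhenomena
open Literature.Probability.FitznerVanDerHofstad2017
open Literature.Probability.FitznerVanDerHofstad2017.NobleBlocks.LenIdx

variable {d : ℕ}

/-! ## A. Re-indexing and endpoint classes -/

section Reindex

/-- **Re-indexing majorisation**: for a fixed out-gap `y`,
`Σ'_x Σ_κ F(−(x+y), e_κ−(x+y)) ≤ Σ'_v Σ'_u F(v, u)` — the map `(x, κ) ↦ (−(x+y), e_κ−(x+y))` is injective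
(`x` is read off the first coordinate, `κ` off the difference `u − v = e_κ`, `stepVec_injective'`); a private helper. [folklore] -/
private theorem tsum_sum_stepVec_shift_le_tsum_tsum (F : Site d → Site d → ℝ≥0∞) (y : Site d) :
    ∑' x, ∑ κ : Fin d × Bool, F (-(x + y)) (stepVec κ - (x + y)) ≤ ∑' v, ∑' u, F v u := by
  classical
  have hinj : Function.Injective
      (fun q : Site d × (Fin d × Bool) => (-(q.1 + y), stepVec q.2 - (q.1 + y))) := by
    rintro ⟨x, κ⟩ ⟨x', κ'⟩ h
    simp only [Prod.mk.injEq] at h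
    obtain ⟨h1, h2⟩ := h
    have hx : x = x' := add_right_cancel (neg_injective h1)
    subst hx
    exact Prod.ext rfl (stepVec_injective' (sub_left_injective h2))
  calc ∑' x, ∑ κ : Fin d × Bool, F (-(x + y)) (stepVec κ - (x + y))
      = ∑' x, ∑' κ : Fin d × Bool, F (-(x + y)) (stepVec κ - (x + y)) :=
        tsum_congr fun x => (tsum_fintype _).symm
    _ = ∑' q : Site d × (Fin d × Bool), F (-(q.1 + y)) (stepVec q.2 - (q.1 + y)) :=
        (ENNReal.tsum_prod (f := fun x κ => F (-(x + y)) (stepVec κ - (x + y)))).symm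
    _ ≤ ∑' r : Site d × Site d, F r.1 r.2 :=
        ENNReal.tsum_comp_le_tsum_of_injective hinj (fun r : Site d × Site d => F r.1 r.2)
    _ = ∑' v, ∑' u, F v u := ENNReal.tsum_prod

/-- Every site is `0`, or has odd `ℓ¹`-norm, or is a non-zero site of even `ℓ¹`-norm. [folklore] -/
private theorem eq_zero_or_odd_or_even (v : Site d) :
    v = 0 ∨ l1Norm v % 2 = 1 ∨ (v ≠ 0 ∧ l1Norm v % 2 = 0) := by
  by_cases hv : v = 0
  · exact Or.inl hv
  · rcases Nat.mod_two_eq_zero_or_one (l1Norm v) with h | h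
    · exact Or.inr (Or.inr ⟨hv, h⟩)
    · exact Or.inr (Or.inl h)

/-- `ofReal` of a three-way `max` dominates each member (left). [folklore] -/
private theorem ofReal_le_ofReal_max₁ {a b c t : ℝ} (h : t ≤ a) :
    ENNReal.ofReal t ≤ ENNReal.ofReal (max a (max b c)) :=
  ENNReal.ofReal_le_ofReal (h.trans (le_max_left _ _))

/-- `ofReal` of a three-way `max` dominates each member (middle). [folklore] -/
private theorem ofReal_le_ofReal_max₂ {a b c t : ℝ} (h : t ≤ b) :
    ENNReal.ofReal t ≤ ENNReal.ofReal (max a (max b c)) :=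
  ENNReal.ofReal_le_ofReal (h.trans ((le_max_left _ _).trans (le_max_right _ _)))

/-- `ofReal` of a three-way `max` dominates each member (right). [folklore] -/
private theorem ofReal_le_ofReal_max₃ {a b c t : ℝ} (h : t ≤ c) :
    ENNReal.ofReal t ≤ ENNReal.ofReal (max a (max b c)) :=
  ENNReal.ofReal_le_ofReal (h.trans ((le_max_right _ _).trans (le_max_right _ _)))

end Reindex

/-! ## B. The cell `(Ā''^ι)_{0,2}` by EXL-XSLOT -/

section Cells

variable (p : unitInterval)

/-- **The `y`-member of `(Ā''^ι)_{0,2}` by EXL-XSLOT at the endpoint `−y`** (`d ≥ 2`, `p < p_c`, `1 ≤ M`,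
`−y ∈ X`, `N` majorises the trail-word counts to `−y`, `R₁` valid for `[M]`, `R₂` for `[M−1, 1]` on `X`):
`Σ'_x Σ_κ T_{≥1,1̲,≥0}(−(x+y), e_κ−(x+y), −y) ≤ ofReal (bubbleSlotR p Γ̄₂ 1 1 M N R₁ R₂)` — re-indexing, then the
interior-exact-leg slot bound `(m₁, m₃) = (1, 0)`.
[cite: FitznerVanDerHofstad2017, §6.1 "Case a = 0, b ≥ 2" (arXiv:1506.07977v2 p. 59); §4.2 (4.17)–(4.18) (p. 36)]
[cite: FitznerVanDerHofstad2016NoBLE, §5.3.2 (5.40) (PTRF 169 (2017) p. 1098)] -/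
theorem perc_tsum_sum_T_shift_le_xslot (hd : 2 ≤ d) (hp : p < criticalProbI d) {M : ℕ} (hM : 1 ≤ M)
    (y : Site d) {X : Set (Site d)} (hx : -y ∈ X) {N : ℕ → ℕ}
    (hN : ∀ L, (trailWordsTo d L (-y)).card ≤ N L) {R₁ R₂ : ℝ} (hR₁ : IsRemKernelConst d [M] X R₁)
    (hR₂ : IsRemKernelConst d [M - 1, 1] X R₂) :
    ∑' x, ∑ κ : Fin d × Bool, (Letters.perc d p).T (.ge 1) (.eq 1) (.ge 0) (-(x + y)) (stepVec κ - (x + y)) (-y) ≤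
      ENNReal.ofReal (bubbleSlotR p (nobleSup2 d p) 1 1 M N R₁ R₂) :=
  (tsum_sum_stepVec_shift_le_tsum_tsum
      (fun v u => (Letters.perc d p).T (.ge 1) (.eq 1) (.ge 0) v u (-y)) y).trans
    (tsum_tsum_perc_T_ge_eqOne_ge_le_ofReal p hd hp (m₁ := 1) (m₃ := 0) (show 1 + 0 ≤ M by omega) hx hN hR₁
      (show IsRemKernelConst d [M - (1 + 0), 1 + 0] X R₂ by simpa using hR₂))

/-- **`(Ā''^ι)_{0,2}` by EXL-XSLOT, endpoint classes** (§6.1-typed entry, repulsive `T_{1,1̲,0}`):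
`(Ā''^ι)_{0,2} = sup_y Σ'_x Σ_κ T_{≥1,1̲,≥0}(−(x+y), e_κ−(x+y), −y)` is at most
`ofReal (max (bubbleSlotR p Γ̄₂ 1 1 M₀ N₀ A₁ A₂) (max (… M₁ N₁ B₁ B₂) (… M₂ N₂ C₁ C₂)))` — slot lists `[M_c]`, `[M_c−1, 1]`
on the endpoint classes `{0}`, odd, even `≠ 0`, each class at its OWN slot order `M_c ≥ 1`, with its own count majorant
and remainder constants; no peel, no `2d·p`, no `K`.
[cite: FitznerVanDerHofstad2017, §6.1 "Case a = 0, b ≥ 2" (arXiv:1506.07977v2 p. 59); §5.1 "Elements of the bounds" (p. 49); App. B (B.5c) row (0,2) (p. 78)]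
[cite: FitznerVanDerHofstad2016NoBLE, §5.3.2 (5.40) (PTRF 169 (2017) p. 1098)] -/
theorem perc_matAbarIota''_zero_two_le_xslot₃ (hd : 2 ≤ d) (hp : p < criticalProbI d)
    {M₀ M₁ M₂ : ℕ} (hM₀ : 1 ≤ M₀) (hM₁ : 1 ≤ M₁) (hM₂ : 1 ≤ M₂)
    {N₀ N₁ N₂ : ℕ → ℕ} (hN₀ : ∀ L, (trailWordsTo d L (0 : Site d)).card ≤ N₀ L)
    (hN₁ : ∀ L (v : Site d), l1Norm v % 2 = 1 → (trailWordsTo d L v).card ≤ N₁ L)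
    (hN₂ : ∀ L (v : Site d), v ≠ 0 → l1Norm v % 2 = 0 → (trailWordsTo d L v).card ≤ N₂ L)
    {A₁ A₂ B₁ B₂ C₁ C₂ : ℝ}
    (hA₁ : IsRemKernelConst d [M₀] ({0} : Set (Site d)) A₁)
    (hA₂ : IsRemKernelConst d [M₀ - 1, 1] ({0} : Set (Site d)) A₂)
    (hB₁ : IsRemKernelConst d [M₁] {v : Site d | l1Norm v % 2 = 1} B₁)
    (hB₂ : IsRemKernelConst d [M₁ - 1, 1] {v : Site d | l1Norm v % 2 = 1} B₂)
    (hC₁ : IsRemKernelConst d [M₂] {v : Site d | v ≠ 0 ∧ l1Norm v % 2 = 0} C₁)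
    (hC₂ : IsRemKernelConst d [M₂ - 1, 1] {v : Site d | v ≠ 0 ∧ l1Norm v % 2 = 0} C₂) :
    matAbarIota'' (Letters.perc d p) 0 2 ≤ ENNReal.ofReal (max (bubbleSlotR p (nobleSup2 d p) 1 1 M₀ N₀ A₁ A₂)
      (max (bubbleSlotR p (nobleSup2 d p) 1 1 M₁ N₁ B₁ B₂) (bubbleSlotR p (nobleSup2 d p) 1 1 M₂ N₂ C₁ C₂))) := by
  rw [matAbarIota''_zero_two]
  refine iSup_le fun y => ?_
  rcases eq_zero_or_odd_or_even (-y) with hv | hv | hv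
  · have h0 : ∀ L, (trailWordsTo d L (-y)).card ≤ N₀ L := fun L => by rw [hv]; exact hN₀ L
    exact (perc_tsum_sum_T_shift_le_xslot p hd hp hM₀ y (show -y ∈ ({0} : Set (Site d)) from hv) h0 hA₁
      hA₂).trans (ofReal_le_ofReal_max₁ le_rfl)
  · exact (perc_tsum_sum_T_shift_le_xslot p hd hp hM₁ y (show -y ∈ {v : Site d | l1Norm v % 2 = 1} from hv)
      (fun L => hN₁ L (-y) hv) hB₁ hB₂).trans (ofReal_le_ofReal_max₂ le_rfl)
  · exact (perc_tsum_sum_T_shift_le_xslot p hd hp hM₂ y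
      (show -y ∈ {v : Site d | v ≠ 0 ∧ l1Norm v % 2 = 0} from hv) (fun L => hN₂ L (-y) hv.1 hv.2) hC₁ hC₂).trans
      (ofReal_le_ofReal_max₃ le_rfl)

/-- **`(Ā''^ι)_{0,2}` by EXL-XSLOT, one class**: with a count majorant `N` valid at EVERY endpoint and remainder
constants on all of `ℤ^d`, `(Ā''^ι)_{0,2} ≤ ofReal (bubbleSlotR p Γ̄₂ 1 1 M N R₁ R₂)` (`1 ≤ M`).
[cite: FitznerVanDerHofstad2017, §6.1 "Case a = 0, b ≥ 2" (arXiv:1506.07977v2 p. 59); §5.1 "Elements of the bounds" (p. 49)]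
[cite: FitznerVanDerHofstad2016NoBLE, §5.3.2 (5.40) (PTRF 169 (2017) p. 1098)] -/
theorem perc_matAbarIota''_zero_two_le_xslot (hd : 2 ≤ d) (hp : p < criticalProbI d) {M : ℕ} (hM : 1 ≤ M)
    {N : ℕ → ℕ} (hN : ∀ L (v : Site d), (trailWordsTo d L v).card ≤ N L) {R₁ R₂ : ℝ}
    (hR₁ : IsRemKernelConst d [M] (Set.univ : Set (Site d)) R₁)
    (hR₂ : IsRemKernelConst d [M - 1, 1] (Set.univ : Set (Site d)) R₂) :
    matAbarIota'' (Letters.perc d p) 0 2 ≤ ENNReal.ofReal (bubbleSlotR p (nobleSup2 d p) 1 1 M N R₁ R₂) := by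
  rw [matAbarIota''_zero_two]
  exact iSup_le fun y => perc_tsum_sum_T_shift_le_xslot p hd hp hM y (Set.mem_univ _) (fun L => hN L (-y)) hR₁ hR₂

end Cells

end Literature.Probability.FitznerVanDerHofstad2017.NobleBlocks
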